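import Summits.QuantumAdvantage.QuantumAdvantage.Theorems.NearExactIsExact.Negative.DerivativeBias
import Summits.QuantumAdvantage.QuantumAdvantage.Theorems.CubicForrelationNearExactIsExactLrdrPin

/-!
# `NearExactIsExact` (stmt-QuantumAdvantage-14043) — negative-side structural lemma (disprove, gen 30):
  the ENTRYWISE TRANSPOSE LAW for derivative Walsh tables of near-exact pairs

For real `G` on `n` bits the tree's derivative Walsh table is `T_G(h,u) = Σ_x G(x) G(x ⊕ h) (-1)^{u·x}`
(`DerivativeWalsh.dwt G h u`; for `G = (-1)^g` it is the Walsh coefficient at `u` of the derivative `D_h g`).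
The tree already has the `ℓ²` transpose identity `Σ_{h,u} (T_f(h,u) − T_g(u,h))² = 2·8ⁿ·(1 − Φ(f,g)²)`
(`DerivativeWalsh.sum_sq_sub_eq`) and its exact case `Φ² = 1 ⇒ T_g = T_fᵀ`
(`dwt_transpose_of_forrelation_sq_eq_one`).  Here we prove the ENTRYWISE bound, sharper per entry by the
factor `2^{n-1}`: for ALL Boolean `f, g` on `n` bits and ALL `a, b` (no degree hypothesis, no `a ≠ 0`),

  **`(T_f(a,b) − T_g(b,a))² ≤ 4·4ⁿ·(1 − Φ(f,g)²)`**,  i.e.  `|T_f(a,b) − T_g(b,a)| ≤ 2^{n+1} √(1 − Φ(f,g)²)`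
  (`tt_entry_sq_le`, `tt_entry_abs_le`).

At `b = 0`, `a ≠ 0` the entry `T_g(0,a) = Σ_y (-1)^{a·y}` vanishes and `T_f(a,0) = Δ_f(a)` is the
autocorrelation, so this contains gen 29's derivative-bias bound `Δ_f(a)² ≤ 4·4ⁿ(1 − Φ²)`
(`Negative/DerivativeBias.db_autocorr_sq_le_left`, not restated).  Proof: the
shifted–twisted correlation `C_{p,q}(a,b) = Σ_x p(x) q(x ⊕ a) (-1)^{b·x}` satisfies `C_{σ_f,σ_f} = T_f(a,b)` and
`C_{W_g,W_g}(a,b) = 2ⁿ·T_g(b,a)` (`tt_corr_W`: the derivative table of the Walsh transform is `2ⁿ` times the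
TRANSPOSED table — Parseval/orthogonality), and with `u = W_g ∓ K σ_f` (`K = √(2ⁿ)`)
`C_{u₋,u₊} + C_{u₊,u₋} = 2 (C_{W_g,W_g} − K² C_{σ_f,σ_f})`; Cauchy–Schwarz and the two defect energies
`‖u∓‖² = 2·4ⁿ(1 ∓ Φ)` (`hl_defect_energy`, `db_plus_energy`) finish.

Consequences. (`tt_forrelation_sq_le_of_entry_gap`) if ONE entry pair differs by `≥ 2ⁿ/2ʰ` then
`Φ(f,g)² ≤ 1 − 4^{−(h+1)}`.  (`tt_row_transposed_imp_product`, Walsh inversion) a fully transposed row,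
`T_f(a,·) = T_g(·,a)`, forces the POINTWISE identity `2ⁿ (-1)^{f x ⊕ f(x ⊕ a)} = W_g(x) W_g(x ⊕ a)` — for an exact
pair (`tt_exact_W_product`) in every direction `a`, so `W_g(x)² = 2ⁿ` (`a = 0`: `g` is bent) and `D_a f = D_a g̃`;
the entrywise law is the quantitative form of this rigidity away from `Φ² = 1`, with NO bentness assumption
(compare the bent-branch row closeness `|T_{g̃}(u,v) − T_f(u,v)| ≤ 4·wt(f ⊕ g̃)` of the prover line's
`stub_perturbRow`).  For CUBIC `f, g` every table entry is `0` or `±2^{(n+r)/2}` (`r` = radical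
dimension of the quadratic derivative), so along a family with `Φ → 1⁻` (a counterexample to `NearExactIsExact`)
a support/sign mismatch `T_f(a,b) ≠ T_g(b,a)` is only possible at entries of radical dimension `r ≤ n − ω(1)`:
the HIGH-radical part of the two derivative tables (near-linear-structure directions) must be exactly transposed,
entry by entry — the uniform version of `Negative/LinearStructure` and `Negative/DerivativeBias`.

Use in the cell: DISPROOF.md §38.  HONEST FRAMING: a structural constraint on near-exact pairs (value = theorem),
NOT summit progress; it neither proves nor refutes `NearExactIsExact`.  Standard axioms.  [folklore]
(Wiener–Khinchin/Parseval bookkeeping: [cite: Carlet2020, Rel. (2.53)]).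
-/

set_option linter.dupNamespace false -- D-0017: single-problem summit ⇒ `QuantumAdvantage.QuantumAdvantage` by design

noncomputable section

namespace Summit.QuantumAdvantage.QuantumAdvantage.Theorems.NearExactIsExact.Negative.TableTranspose

open Finset
open Literature.Computability.QuantumComplexity
open Literature.Computability.QuantumComplexity.BuzetChailloux
  (bxor zeroVec signOf_sq bxor_comm bxor_eq_zeroVec_iff bxorPerm bxorPerm_apply)
open Literature.Computability.QuantumComplexity.DerivativeWalsh (W dwt sum_twist_mul_dwt)
open Literature.Computability.QuantumComplexity.Simon (twist_sq sum_twist twist_xor_left)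
open Literature.Computability.QuantumComplexity.MMReadout (forrelation_symm')
open Summit.QuantumAdvantage.QuantumAdvantage.Theorems.NearExactIsExact.Negative.HyperplaneLeak
  (hl_defect_energy)
open Summit.QuantumAdvantage.QuantumAdvantage.Theorems.NearExactIsExact.Negative.DerivativeBias
  (db_plus_energy)
open Summit.QuantumAdvantage.QuantumAdvantage.Theorems.CubicForrelation.NearExactIsExact
  (lrdr_eq_zero_of_W_eq_zero)

variable {n : ℕ}

/-! ### The transposed table of the Walsh transform -/

/-- The shifted Walsh transform as a twisted character sum: `W_G(x ⊕ a) = Σ_y G(y) (-1)^{y·x} (-1)^{a·y}`.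
[folklore] -/
theorem tt_W_shift (G : (Fin n → Bool) → ℝ) (x a : Fin n → Bool) :
    W G (bxor x a) = ∑ y, G y * twist y x * twist a y := by
  unfold W
  refine sum_congr rfl fun y _ => ?_
  rw [twist_comm y (bxor x a), show bxor x a = fun i => x i ^^ a i from rfl, twist_xor_left,
    twist_comm x y]
  ring

/-- **The derivative table of the Walsh transform is `2ⁿ ×` the transposed table**:
`Σ_x W_G(x) W_G(x ⊕ a) (-1)^{b·x} = 2ⁿ · T_G(b,a)` for every real `G` and all `a, b`.
[cite: Carlet2020, Rel. (2.53)] -/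
theorem tt_corr_W (G : (Fin n → Bool) → ℝ) (a b : Fin n → Bool) :
    ∑ x, W G x * W G (bxor x a) * twist b x = (2 : ℝ) ^ n * dwt G b a := by
  have step : ∀ x : Fin n → Bool,
      W G x * W G (bxor x a) * twist b x = ∑ u, dwt G u a * (twist u x * twist b x) := by
    intro x
    rw [tt_W_shift, ← sum_twist_mul_dwt, sum_mul]
    exact sum_congr rfl fun u _ => by ring
  simp_rw [step]
  rw [sum_comm]
  have e : ∀ u : Fin n → Bool, ∑ x, dwt G u a * (twist u x * twist b x) =
      dwt G u a * (if bxor u b = zeroVec then (2 : ℝ) ^ n else 0) := by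
    intro u
    rw [← mul_sum, show zeroVec = (fun _ : Fin n => false) from rfl, ← sum_twist (bxor u b)]
    congr 1
    refine sum_congr rfl fun x _ => ?_
    rw [show bxor u b = fun i => u i ^^ b i from rfl, twist_xor_left]
  simp_rw [e, bxor_eq_zeroVec_iff, mul_ite, mul_zero]
  rw [Finset.sum_ite_eq' univ b, if_pos (mem_univ _), mul_comm]

/-! ### The entrywise transpose law -/

/-- **Entrywise transpose law.** For ALL Boolean `f, g` on `n` bits and ALL `a, b`:
`(T_f(a,b) − T_g(b,a))² ≤ 4·4ⁿ·(1 − Φ(f,g)²)`, where `T_f(a,b) = Σ_x (-1)^{f x ⊕ f(x ⊕ a) ⊕ b·x}`. [folklore] -/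
theorem tt_entry_sq_le (f g : (Fin n → Bool) → Bool) (a b : Fin n → Bool) :
    (dwt (fun x => signOf (f x)) a b - dwt (fun y => signOf (g y)) b a) ^ 2 ≤
      4 * (4 : ℝ) ^ n * (1 - forrelation f g ^ 2) := by
  set K : ℝ := Real.sqrt ((2 : ℝ) ^ n) with hKdef
  have hK : K ^ 2 = (2 : ℝ) ^ n := Real.sq_sqrt (by positivity)
  set Wg : (Fin n → Bool) → ℝ := W (fun y => signOf (g y)) with hWg
  set σ : (Fin n → Bool) → ℝ := fun x => signOf (f x) with hσ
  -- the two Cauchy–Schwarz sums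
  set X : ℝ := ∑ x, ((Wg x - K * σ x) * twist b x) * (Wg (bxor x a) + K * σ (bxor x a)) with hX
  set Y : ℝ := ∑ x, ((Wg x + K * σ x) * twist b x) * (Wg (bxor x a) - K * σ (bxor x a)) with hY
  -- representation of the entry difference
  have hWW := tt_corr_W (fun y => signOf (g y)) a b
  have hrepr : 2 * (2 : ℝ) ^ n * (dwt (fun y => signOf (g y)) b a - dwt σ a b) = X + Y := by
    have e : ∀ x : Fin n → Bool,
        ((Wg x - K * σ x) * twist b x) * (Wg (bxor x a) + K * σ (bxor x a)) +
          ((Wg x + K * σ x) * twist b x) * (Wg (bxor x a) - K * σ (bxor x a)) =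
        2 * (Wg x * Wg (bxor x a) * twist b x) - 2 * K ^ 2 * (σ x * σ (bxor x a) * twist b x) := by
      intro x; ring
    rw [hX, hY, ← sum_add_distrib, sum_congr rfl fun x _ => e x, sum_sub_distrib, ← mul_sum, ← mul_sum,
      hWg, hWW, hK]
    unfold dwt
    ring
  -- energies
  have hA : ∑ x, ((Wg x - K * σ x) * twist b x) ^ 2 = 2 * ((2 : ℝ) ^ n) ^ 2 * (1 - forrelation f g) := by
    rw [← hl_defect_energy f g]
    exact sum_congr rfl fun x _ => by rw [mul_pow, twist_sq, mul_one]
  have hB : ∑ x, ((Wg x + K * σ x) * twist b x) ^ 2 = 2 * ((2 : ℝ) ^ n) ^ 2 * (1 + forrelation f g) := by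
    rw [← db_plus_energy f g]
    exact sum_congr rfl fun x _ => by rw [mul_pow, twist_sq, mul_one]
  -- translation invariance `Σ_x F(x ⊕ a) = Σ_x F(x)` (reindex by the involution `bxorPerm a`)
  have hshift : ∀ F : (Fin n → Bool) → ℝ, ∑ x, F (bxor x a) = ∑ x, F x := fun F => by
    rw [show (fun x => F (bxor x a)) = fun x => F (bxorPerm a x) from
      funext fun x => by rw [bxorPerm_apply, bxor_comm]]
    exact Equiv.sum_comp (bxorPerm a) F
  have hA' : ∑ x, (Wg (bxor x a) - K * σ (bxor x a)) ^ 2 = 2 * ((2 : ℝ) ^ n) ^ 2 * (1 - forrelation f g) := by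
    rw [hshift (fun x => (Wg x - K * σ x) ^ 2), ← hl_defect_energy f g]
  have hB' : ∑ x, (Wg (bxor x a) + K * σ (bxor x a)) ^ 2 = 2 * ((2 : ℝ) ^ n) ^ 2 * (1 + forrelation f g) := by
    rw [hshift (fun x => (Wg x + K * σ x) ^ 2), ← db_plus_energy f g]
  -- Cauchy–Schwarz
  have hCS1 := sum_mul_sq_le_sq_mul_sq (univ : Finset (Fin n → Bool))
    (fun x => (Wg x - K * σ x) * twist b x) (fun x => Wg (bxor x a) + K * σ (bxor x a))
  have hCS2 := sum_mul_sq_le_sq_mul_sq (univ : Finset (Fin n → Bool))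
    (fun x => (Wg x + K * σ x) * twist b x) (fun x => Wg (bxor x a) - K * σ (bxor x a))
  rw [← hX, hA, hB'] at hCS1
  rw [← hY, hB, hA'] at hCS2
  -- combine: `(X + Y)² ≤ 2X² + 2Y² ≤ 4 · E₋ E₊`
  have hN : (0 : ℝ) < (2 * (2 : ℝ) ^ n) ^ 2 := by positivity
  have h4 : (4 : ℝ) ^ n = ((2 : ℝ) ^ n) ^ 2 := by rw [sq, ← mul_pow]; norm_num
  have hsum : (X + Y) ^ 2 ≤ 2 * X ^ 2 + 2 * Y ^ 2 := by nlinarith [sq_nonneg (X - Y)]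
  have key : (2 * (2 : ℝ) ^ n) ^ 2 * (dwt (fun x => signOf (f x)) a b - dwt (fun y => signOf (g y)) b a) ^ 2 ≤
      (2 * (2 : ℝ) ^ n) ^ 2 * (4 * (4 : ℝ) ^ n * (1 - forrelation f g ^ 2)) := by
    have e : (2 * (2 : ℝ) ^ n) ^ 2 * (dwt (fun x => signOf (f x)) a b - dwt (fun y => signOf (g y)) b a) ^ 2 =
        (X + Y) ^ 2 := by rw [← hrepr, hσ]; ring
    rw [e, h4]
    refine hsum.trans ?_
    nlinarith [hCS1, hCS2]
  exact le_of_mul_le_mul_left key hN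

/-- **`|T_f(a,b) − T_g(b,a)| ≤ 2^{n+1} √(1 − Φ(f,g)²)`** (all `f, g, a, b`, all `n`). [folklore] -/
theorem tt_entry_abs_le (f g : (Fin n → Bool) → Bool) (a b : Fin n → Bool) :
    |dwt (fun x => signOf (f x)) a b - dwt (fun y => signOf (g y)) b a| ≤
      2 * (2 : ℝ) ^ n * Real.sqrt (1 - forrelation f g ^ 2) := by
  have h := tt_entry_sq_le f g a b
  have hpos : (0 : ℝ) ≤ 2 * (2 : ℝ) ^ n := by positivity
  rw [← Real.sqrt_sq_eq_abs, show 2 * (2 : ℝ) ^ n = Real.sqrt ((2 * (2 : ℝ) ^ n) ^ 2) from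
    (Real.sqrt_sq hpos).symm, ← Real.sqrt_mul (by positivity)]
  refine Real.sqrt_le_sqrt (h.trans (le_of_eq ?_))
  rw [show (4 : ℝ) ^ n = ((2 : ℝ) ^ n) ^ 2 by rw [sq, ← mul_pow]; norm_num]
  ring

/-- The law is symmetric: `(T_g(a,b) − T_f(b,a))² ≤ 4·4ⁿ(1 − Φ(f,g)²)` as well. [folklore] -/
theorem tt_entry_sq_le' (f g : (Fin n → Bool) → Bool) (a b : Fin n → Bool) :
    (dwt (fun y => signOf (g y)) a b - dwt (fun x => signOf (f x)) b a) ^ 2 ≤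
      4 * (4 : ℝ) ^ n * (1 - forrelation f g ^ 2) := by
  rw [← forrelation_symm']
  exact tt_entry_sq_le g f a b

/-! ### A single badly transposed entry caps `Φ` -/

/-- **One entry gap caps `Φ`.**  If `|T_f(a,b) − T_g(b,a)| ≥ 2ⁿ/2ʰ` for some `a, b`, then
`Φ(f,g)² ≤ 1 − 4^{−(h+1)}`.  (For cubic `f, g` the entries are `0` or `±2^{(n+r)/2}`, `r` the radical
dimension of the quadratic derivative, so a support mismatch at radical dimension `r` gives `h = (n − r)/2`.)
[folklore] -/
theorem tt_forrelation_sq_le_of_entry_gap (f g : (Fin n → Bool) → Bool) (a b : Fin n → Bool) {h : ℕ}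
    (hgap : (2 : ℝ) ^ n ≤ (2 : ℝ) ^ h *
      |dwt (fun x => signOf (f x)) a b - dwt (fun y => signOf (g y)) b a|) :
    forrelation f g ^ 2 ≤ 1 - 1 / (4 * (4 : ℝ) ^ h) := by
  have hb := tt_entry_sq_le f g a b
  set D : ℝ := dwt (fun x => signOf (f x)) a b - dwt (fun y => signOf (g y)) b a with hD
  have h4n : (4 : ℝ) ^ n = ((2 : ℝ) ^ n) ^ 2 := by rw [sq, ← mul_pow]; norm_num
  have h4h : (4 : ℝ) ^ h = ((2 : ℝ) ^ h) ^ 2 := by rw [sq, ← mul_pow]; norm_num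
  have hsq : (4 : ℝ) ^ n ≤ (4 : ℝ) ^ h * D ^ 2 := by
    rw [h4n, h4h, ← sq_abs D, ← mul_pow]
    exact pow_le_pow_left₀ (by positivity) hgap 2
  have hposn : (0 : ℝ) < (4 : ℝ) ^ n := by positivity
  have hposh : (0 : ℝ) < 4 * (4 : ℝ) ^ h := by positivity
  have hc : (4 : ℝ) ^ n * 1 ≤ (4 : ℝ) ^ n * (4 * (4 : ℝ) ^ h * (1 - forrelation f g ^ 2)) := by
    rw [mul_one]
    refine hsq.trans ?_
    have := mul_le_mul_of_nonneg_left hb (by positivity : (0 : ℝ) ≤ (4 : ℝ) ^ h)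
    refine this.trans (le_of_eq ?_)
    ring
  have hd := le_of_mul_le_mul_left hc hposn
  have he : 1 / (4 * (4 : ℝ) ^ h) ≤ 1 - forrelation f g ^ 2 := by
    rw [div_le_iff₀ hposh]
    linarith
  linarith

/-- **Exact pairs have transposed tables** (the tree's `dwt_transpose_of_forrelation_sq_eq_one`, recovered
from the entrywise law): `Φ(f,g)² = 1 ⇒ T_f(a,b) = T_g(b,a)`. [folklore] -/
theorem tt_exact_transpose (f g : (Fin n → Bool) → Bool) (h1 : forrelation f g ^ 2 = 1) (a b : Fin n → Bool) :
    dwt (fun x => signOf (f x)) a b = dwt (fun y => signOf (g y)) b a := by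
  have h := tt_entry_sq_le f g a b
  rw [h1, sub_self, mul_zero] at h
  exact sub_eq_zero.1 (pow_eq_zero_iff (n := 2) (by norm_num) |>.1 (le_antisymm h (sq_nonneg _)))

/-! ### A transposed row is a pointwise identity (Walsh inversion) -/

/-- **A fully transposed row forces a pointwise product identity.**  If row `a` of `T_f` equals column `a` of
`T_g`, `T_f(a,b) = T_g(b,a)` for all `b`, then `2ⁿ (-1)^{f x} (-1)^{f(x ⊕ a)} = W_g(x) W_g(x ⊕ a)` for every `x`
(both sides have the same Walsh transform in `b`, by `tt_corr_W`; Walsh inversion `lrdr_eq_zero_of_W_eq_zero`).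
[cite: ODonnell2014, §1.4] -/
theorem tt_row_transposed_imp_product (f g : (Fin n → Bool) → Bool) (a : Fin n → Bool)
    (hrow : ∀ b, dwt (fun x => signOf (f x)) a b = dwt (fun y => signOf (g y)) b a) (x : Fin n → Bool) :
    (2 : ℝ) ^ n * (signOf (f x) * signOf (f (bxor x a))) =
      W (fun y => signOf (g y)) x * W (fun y => signOf (g y)) (bxor x a) := by
  have h2 : (2 : ℝ) ^ n ≠ 0 := pow_ne_zero _ two_ne_zero
  set Wg : (Fin n → Bool) → ℝ := W (fun y => signOf (g y)) with hWg
  have hP := lrdr_eq_zero_of_W_eq_zero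
    (fun x => signOf (f x) * signOf (f (bxor x a)) - ((2 : ℝ) ^ n)⁻¹ * (Wg x * Wg (bxor x a))) ?_ x
  · have e := sub_eq_zero.1 hP
    rw [e, mul_inv_cancel_left₀ h2]
  intro v
  unfold W
  simp_rw [sub_mul]
  rw [sum_sub_distrib]
  have h1 : ∑ x, signOf (f x) * signOf (f (bxor x a)) * twist x v = dwt (fun x => signOf (f x)) a v := by
    unfold dwt
    exact sum_congr rfl fun x _ => by rw [twist_comm x v]
  have h3 : ∑ x, ((2 : ℝ) ^ n)⁻¹ * (Wg x * Wg (bxor x a)) * twist x v =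
      ((2 : ℝ) ^ n)⁻¹ * ∑ x, Wg x * Wg (bxor x a) * twist v x := by
    rw [mul_sum]
    exact sum_congr rfl fun x _ => by rw [twist_comm x v]; ring
  rw [h1, h3, hWg, tt_corr_W, hrow v, inv_mul_cancel_left₀ h2, sub_self]

/-- **Exact pairs, pointwise**: `Φ(f,g)² = 1 ⇒ W_g(x) W_g(x ⊕ a) = 2ⁿ (-1)^{f x ⊕ f(x ⊕ a)}` for all `x, a`
(at `a = 0`: `W_g(x)² = 2ⁿ`, `g` is bent; in general `D_a f` is the derivative of the dual). [folklore] -/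
theorem tt_exact_W_product (f g : (Fin n → Bool) → Bool) (h1 : forrelation f g ^ 2 = 1) (x a : Fin n → Bool) :
    W (fun y => signOf (g y)) x * W (fun y => signOf (g y)) (bxor x a) =
      (2 : ℝ) ^ n * (signOf (f x) * signOf (f (bxor x a))) :=
  (tt_row_transposed_imp_product f g a (fun b => tt_exact_transpose f g h1 a b) x).symm

end Summit.QuantumAdvantage.QuantumAdvantage.Theorems.NearExactIsExact.Negative.TableTranspose
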